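import Literature.Geometry.ComplexHyperbolic.UnitBallLieAlgebraOrbitalDefs   -- (a0) p846448: `lieBasis`, `lieWeight`, `lieLaplacian`, `torusH`, `J`, `mat`
import HarnessLib

/-!
# The Casimir tensor of `(𝔲(2,1), Re tr)` is `Ad(U(2,1))`-invariant — against every real bilinear pairing
# (ROAD «A6-IV» brick (b0), prerequisite of the flat Casimir identity (b1); Warner II §8.4.1; Helgason, *Groups and Geometric Analysis* Ch. II §5)

Topic `Geometry/ComplexHyperbolic`; namespace `Literature.Geometry.ComplexHyperbolic.BallModel`.  THEOREMS ONLY (no `def`, no instance, no notation, no axiom, no named fact, no `sorry`).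
Cell `pub/hodgecm-mathlib`, ENGINE T1 (crux H413 = `stmt-HodgeConjecture-24833`); ROAD A, design of record `DESIGN-A6-InHouse-v2-ArchitectureIV` 93542b84 (LEAD T11-4), SPEC fb65bd65 (b0);
author F0P3a-p05 (g15) (ROAD A owner), 2026-09-01.

THE MATHEMATICS.  `𝔤 = 𝔲(2,1) = {U | Uᴴ J + J U = 0}` carries the non-degenerate symmetric form `B(U,V) = Re tr(UV)`; ★ (a0) `lieBasis` `E_0…E_8` is `B`-orthogonal with `B(E_a,E_a) = 1∕w_a`,
`w = lieWeight`.  §1: `Ad(g)` (`g ∈ U(2,1)`) preserves `𝔤` and `B`.  §2: the orthogonality TABLE `Re tr(E_a E_b) = δ_{ab}∕w_a`.  §3: the REPRODUCING identity — every `U ∈ 𝔤` is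
`U = Σ_a w_a·Re tr(U E_a)·E_a` (so `(E_a)`, `(w_a E_a)` are `B`-dual bases) — and its consequence `Σ_a w_a·Re tr(E_a U)·Re tr(E_a U′) = Re tr(U U′)` on `𝔤`.  §4: for EVERY continuous real
bilinear `T : M₃(ℂ) × M₃(ℂ) → E` (typed as a `ContinuousMultilinearMap` on `Fin 2`, the shape of `iteratedFDeriv ℝ 2 f X`) and every `g ∈ U(2,1)`:
  **`Σ_a w_a • T[Ad_g E_a, Ad_g E_a] = Σ_a w_a • T[E_a, E_a]`**
(expand `Ad_g E_a = Σ_b w_b Re tr(Ad_g E_a·E_b) E_b` by §3, exchange sums, and evaluate `Σ_a w_a c_{ab} c_{ab′} = δ_{bb′} w_b` by §3 applied to `Ad_{g⁻¹}E_b` and §1).  §5: hence HC's `∂(ω)` is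
`Ad`-invariant in the form the radial computation (b1) consumes: `(lieLaplacian f)(X) = Σ_a w_a • D²f(X)[Ad_g E_a, Ad_g E_a]` for any `g`, at any `X`.
HONEST LABEL: HC_CM is proved only modulo the printed citations until rung 0 closes; linear algebra, pays nothing by itself.

## References
* [WarnerHASSLG2] G. Warner, *Harmonic Analysis on Semi-Simple Lie Groups II*, Grundlehren 189 (1972), §8.4.1, §8.4.3.
* [Helgason2000] S. Helgason, *Groups and Geometric Analysis* (2000), Ch. II §5 (the Casimir operator and its radial part).
-/

set_option autoImplicit false

noncomputable section

open Matrix Complex ComplexConjugate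

open scoped Matrix.Norms.Operator

namespace Literature.Geometry.ComplexHyperbolic

namespace BallModel

/-! ## §1 `Ad(g)` preserves `𝔲(2,1)` and the trace form -/

section Ad

/-- `Ad(g)` preserves `𝔲(2,1)`: if `Uᴴ J + J U = 0` then the same holds for `mat g · U · mat g⁻¹` (`mat g⁻¹ = J (mat g)ᴴ J`). [cite: WarnerHASSLG2, §8.4.1] -/
theorem conj_mem_lieAlgebra (g : U21) {U : Matrix (Fin 3) (Fin 3) ℂ} (hU : Uᴴ * J + J * U = 0) :
    (mat g * U * mat g⁻¹)ᴴ * J + J * (mat g * U * mat g⁻¹) = 0 := by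
  have hUJ : J * Uᴴ * J = -U := by
    have h1 : Uᴴ * J = -(J * U) := eq_neg_of_add_eq_zero_left hU
    rw [Matrix.mul_assoc, h1, Matrix.mul_neg, ← Matrix.mul_assoc, J_mul_J, Matrix.one_mul]
  have hginv : mat g⁻¹ = J * (mat g)ᴴ * J := mat_inv g
  have hgHJ : (mat g)ᴴ * J = J * mat g⁻¹ := by
    rw [hginv, ← Matrix.mul_assoc, ← Matrix.mul_assoc, J_mul_J, Matrix.one_mul]
  -- `(g U g⁻¹)ᴴ = (g⁻¹)ᴴ Uᴴ gᴴ = (J g J) Uᴴ gᴴ` (`Jᴴ = J`, ★ `BallForms.conjTranspose_J` in the Cauchy–Riemann file; re-derived inline to keep imports light)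
  have conjTranspose_J : Jᴴ = J := by
    ext i j
    fin_cases i <;> fin_cases j <;> simp [J, Matrix.conjTranspose_apply]
  have hT : (mat g * U * mat g⁻¹)ᴴ = J * mat g * J * Uᴴ * (mat g)ᴴ := by
    rw [Matrix.conjTranspose_mul, Matrix.conjTranspose_mul, hginv, Matrix.conjTranspose_mul, Matrix.conjTranspose_mul,
      conjTranspose_J, Matrix.conjTranspose_conjTranspose]
    simp only [Matrix.mul_assoc]
  rw [hT]
  calc J * mat g * J * Uᴴ * (mat g)ᴴ * J + J * (mat g * U * mat g⁻¹)
      = J * mat g * (J * Uᴴ * J) * mat g⁻¹ + J * (mat g * U * mat g⁻¹) := by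
        rw [show J * mat g * J * Uᴴ * (mat g)ᴴ * J = J * mat g * J * Uᴴ * ((mat g)ᴴ * J) by simp only [Matrix.mul_assoc], hgHJ]
        simp only [Matrix.mul_assoc]
    _ = 0 := by rw [hUJ]; simp only [Matrix.mul_neg, Matrix.neg_mul, Matrix.mul_assoc, neg_add_cancel]

/-- `Ad(g)` preserves the trace form: `tr(Ad_g U · Ad_g V) = tr(U V)`. [cite: WarnerHASSLG2, §8.4.1] -/
theorem trace_conj_mul_conj (g : U21) (U V : Matrix (Fin 3) (Fin 3) ℂ) :
    Matrix.trace (mat g * U * mat g⁻¹ * (mat g * V * mat g⁻¹)) = Matrix.trace (U * V) := by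
  have hgg : mat g⁻¹ * mat g = 1 := by rw [← mat_mul, inv_mul_cancel, mat_one]
  have h : mat g * U * mat g⁻¹ * (mat g * V * mat g⁻¹) = mat g * (U * V) * mat g⁻¹ := by
    calc mat g * U * mat g⁻¹ * (mat g * V * mat g⁻¹) = mat g * U * (mat g⁻¹ * mat g) * V * mat g⁻¹ := by simp only [Matrix.mul_assoc]
      _ = mat g * (U * V) * mat g⁻¹ := by rw [hgg, Matrix.mul_one]; simp only [Matrix.mul_assoc]
  rw [h, Matrix.trace_mul_cycle, hgg, Matrix.one_mul]

/-- Trace cyclicity in the `Ad` form: `tr(Ad_g U · V) = tr(U · Ad_{g⁻¹} V)`. [cite: WarnerHASSLG2, §8.4.1] -/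
theorem trace_conj_mul (g : U21) (U V : Matrix (Fin 3) (Fin 3) ℂ) :
    Matrix.trace (mat g * U * mat g⁻¹ * V) = Matrix.trace (U * (mat g⁻¹ * V * mat (g⁻¹)⁻¹)) := by
  rw [inv_inv]
  calc Matrix.trace (mat g * U * mat g⁻¹ * V) = Matrix.trace (mat g * (U * mat g⁻¹ * V)) := by simp only [Matrix.mul_assoc]
    _ = Matrix.trace (U * mat g⁻¹ * V * mat g) := Matrix.trace_mul_comm _ _
    _ = Matrix.trace (U * (mat g⁻¹ * V * mat g)) := by simp only [Matrix.mul_assoc]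

end Ad

/-! ## §2 The orthogonality table of `lieBasis` -/

section Table

/-- **THE BASIS AS LITERAL MATRICES** (for entrywise computation). [cite: WarnerHASSLG2, §8.4.3] -/
theorem lieBasis_eq_literal : lieBasis =
    ![!![I, 0, 0; 0, 0, 0; 0, 0, 0], !![0, 0, 0; 0, I, 0; 0, 0, 0], !![0, 0, 0; 0, 0, 0; 0, 0, I],
      !![0, 1, 0; -1, 0, 0; 0, 0, 0], !![0, I, 0; I, 0, 0; 0, 0, 0],
      !![0, 0, 1; 0, 0, 0; 1, 0, 0], !![0, 0, I; 0, 0, 0; -I, 0, 0],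
      !![0, 0, 0; 0, 0, 1; 0, 1, 0], !![0, 0, 0; 0, 0, I; 0, -I, 0]] := by
  funext a
  fin_cases a <;> (ext i j; fin_cases i <;> fin_cases j <;> simp [lieBasis])

/-- The weights as a literal vector (for `simp`). [cite: WarnerHASSLG2, §8.4.3] -/
theorem lieWeight_eq_literal : lieWeight = ![-1, -1, -1, -1 / 2, -1 / 2, 1 / 2, 1 / 2, 1 / 2, 1 / 2] := rfl

set_option maxHeartbeats 800000 in
/-- **THE TABLE**: `Re tr(E_a E_b) = δ_{ab}∕w_a` — `lieBasis` is `B`-orthogonal with `B(E_a,E_a) = (lieWeight a)⁻¹ ∈ {−1, −2, 2}` (81 literal trace computations). [cite: WarnerHASSLG2, §8.4.3] -/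
theorem re_trace_lieBasis_mul_lieBasis (a b : Fin 9) :
    (Matrix.trace (lieBasis a * lieBasis b)).re = if a = b then (lieWeight a)⁻¹ else 0 := by
  rw [lieBasis_eq_literal, lieWeight_eq_literal]
  fin_cases a <;> fin_cases b <;> simp [Matrix.trace, Fin.sum_univ_three] <;> norm_num

/-- The weights are non-zero. [cite: WarnerHASSLG2, §8.4.3] -/
theorem lieWeight_ne_zero (a : Fin 9) : lieWeight a ≠ 0 := by
  fin_cases a <;> norm_num [lieWeight]

/-- Every `lieBasis a` lies in `𝔲(2,1)`. [cite: WarnerHASSLG2, §8.4.3] -/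
theorem lieBasis_mem (a : Fin 9) : (lieBasis a)ᴴ * J + J * lieBasis a = 0 := by
  rw [lieBasis_eq_literal]
  ext i j
  fin_cases a <;> fin_cases i <;> fin_cases j <;>
    simp [J, Matrix.mul_apply, Matrix.conjTranspose_apply, Matrix.diagonal_apply]

end Table

/-! ## §3 The reproducing identity on `𝔲(2,1)` -/

section Reproducing

/-- Entrywise form of `Uᴴ J + J U = 0`: `conj(U_{ji})·J_{jj} + J_{ii}·U_{ij} = 0`. [cite: WarnerHASSLG2, §8.4.1] -/
theorem conj_mul_J_add_J_mul_of_mem {U : Matrix (Fin 3) (Fin 3) ℂ} (hU : Uᴴ * J + J * U = 0) (i j : Fin 3) :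
    conj (U j i) * J j j + J i i * U i j = 0 := by
  have h := congrFun (congrFun hU i) j
  rw [Matrix.add_apply, Matrix.zero_apply, J, Matrix.mul_diagonal, Matrix.diagonal_mul, Matrix.conjTranspose_apply, Complex.star_def] at h
  rw [J, Matrix.diagonal_apply_eq, Matrix.diagonal_apply_eq]
  exact h

/-- **THE REPRODUCING IDENTITY**: every `U ∈ 𝔲(2,1)` is `Σ_a w_a·Re tr(U E_a)·E_a` — `(E_a)` and `(w_a E_a)` are `B`-dual bases of `𝔲(2,1)`. [cite: WarnerHASSLG2, §8.4.3] [cite: Helgason2000, Ch. II §5] -/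
theorem eq_sum_lieWeight_smul_lieBasis {U : Matrix (Fin 3) (Fin 3) ℂ} (hU : Uᴴ * J + J * U = 0) :
    U = ∑ a : Fin 9, (lieWeight a * (Matrix.trace (U * lieBasis a)).re) • lieBasis a := by
  -- the six entry relations of `𝔲(2,1)`
  have h00 := conj_mul_J_add_J_mul_of_mem hU 0 0
  have h11 := conj_mul_J_add_J_mul_of_mem hU 1 1
  have h22 := conj_mul_J_add_J_mul_of_mem hU 2 2
  have h01 := conj_mul_J_add_J_mul_of_mem hU 0 1
  have h02 := conj_mul_J_add_J_mul_of_mem hU 0 2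
  have h12 := conj_mul_J_add_J_mul_of_mem hU 1 2
  simp only [J_apply_00, J_apply_11, J_apply_22, mul_one, one_mul, mul_neg, neg_mul] at h00 h11 h22 h01 h02 h12
  -- real and imaginary parts of the relations
  have r00 := congrArg Complex.re h00; have r11 := congrArg Complex.re h11; have r22 := congrArg Complex.re h22
  have r01 := congrArg Complex.re h01; have i01 := congrArg Complex.im h01
  have r02 := congrArg Complex.re h02; have i02 := congrArg Complex.im h02
  have r12 := congrArg Complex.re h12; have i12 := congrArg Complex.im h12
  simp only [Complex.add_re, Complex.add_im, Complex.conj_re, Complex.conj_im, Complex.neg_re, Complex.neg_im, Complex.zero_re, Complex.zero_im] at r00 r11 r22 r01 i01 r02 i02 r12 i12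
  rw [lieBasis_eq_literal, lieWeight_eq_literal]
  ext i j
  rw [Matrix.sum_apply]
  simp only [Fin.sum_univ_succ, Fin.sum_univ_zero, Matrix.smul_apply]
  fin_cases i <;> fin_cases j <;>
    simp [Matrix.trace, Fin.sum_univ_three, Matrix.mul_apply] <;>
    apply Complex.ext <;> simp <;> linarith

/-- `B` evaluated through the dual bases: for `U, U′ ∈ 𝔲(2,1)`, `Σ_a w_a·Re tr(E_a U)·Re tr(E_a U′) = Re tr(U U′)`. [cite: Helgason2000, Ch. II §5] -/
theorem sum_lieWeight_mul_re_trace_mul_re_trace {U U' : Matrix (Fin 3) (Fin 3) ℂ} (hU : Uᴴ * J + J * U = 0) :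
    ∑ a : Fin 9, lieWeight a * (Matrix.trace (lieBasis a * U)).re * (Matrix.trace (lieBasis a * U')).re = (Matrix.trace (U * U')).re := by
  conv_rhs => rw [eq_sum_lieWeight_smul_lieBasis hU]
  rw [Finset.sum_mul, Matrix.trace_sum, Complex.re_sum]
  refine Finset.sum_congr rfl fun a _ => ?_
  rw [Matrix.smul_mul, Matrix.trace_smul, Complex.smul_re, smul_eq_mul, Matrix.trace_mul_comm (lieBasis a) U]

end Reproducing

/-! ## §4 Invariance of the Casimir tensor against every continuous bilinear pairing -/

section Invariance

variable {E : Type*} [NormedAddCommGroup E] [NormedSpace ℝ E]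

/-- Additivity of a `Fin 2`-multilinear map in the first slot of `![U, V]`. [cite: Helgason2000, Ch. II §5] -/
theorem cmm_pair_add_left (T : ContinuousMultilinearMap ℝ (fun _ : Fin 2 => Matrix (Fin 3) (Fin 3) ℂ) E) (U U' V : Matrix (Fin 3) (Fin 3) ℂ) :
    T ![U + U', V] = T ![U, V] + T ![U', V] := by
  have h := T.map_update_add ![U, V] 0 U U'
  have e1 : Function.update ![U, V] 0 (U + U') = ![U + U', V] := by ext i : 1; fin_cases i <;> simp
  have e2 : Function.update ![U, V] 0 U = ![U, V] := by ext i : 1; fin_cases i <;> simp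
  have e3 : Function.update ![U, V] 0 U' = ![U', V] := by ext i : 1; fin_cases i <;> simp
  rw [e1, e2, e3] at h
  exact h

/-- Homogeneity of a `Fin 2`-multilinear map in the first slot of `![U, V]`. [cite: Helgason2000, Ch. II §5] -/
theorem cmm_pair_smul_left (T : ContinuousMultilinearMap ℝ (fun _ : Fin 2 => Matrix (Fin 3) (Fin 3) ℂ) E) (c : ℝ) (U V : Matrix (Fin 3) (Fin 3) ℂ) :
    T ![c • U, V] = c • T ![U, V] := by
  have h := T.map_update_smul ![U, V] 0 c U
  have e1 : Function.update ![U, V] 0 (c • U) = ![c • U, V] := by ext i : 1; fin_cases i <;> simp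
  have e2 : Function.update ![U, V] 0 U = ![U, V] := by ext i : 1; fin_cases i <;> simp
  rw [e1, e2] at h
  exact h

/-- Additivity of a `Fin 2`-multilinear map in the second slot of `![U, V]`. [cite: Helgason2000, Ch. II §5] -/
theorem cmm_pair_add_right (T : ContinuousMultilinearMap ℝ (fun _ : Fin 2 => Matrix (Fin 3) (Fin 3) ℂ) E) (U V V' : Matrix (Fin 3) (Fin 3) ℂ) :
    T ![U, V + V'] = T ![U, V] + T ![U, V'] := by
  have h := T.map_update_add ![U, V] 1 V V'
  have e1 : Function.update ![U, V] 1 (V + V') = ![U, V + V'] := by ext i : 1; fin_cases i <;> simp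
  have e2 : Function.update ![U, V] 1 V = ![U, V] := by ext i : 1; fin_cases i <;> simp
  have e3 : Function.update ![U, V] 1 V' = ![U, V'] := by ext i : 1; fin_cases i <;> simp
  rw [e1, e2, e3] at h
  exact h

/-- Homogeneity of a `Fin 2`-multilinear map in the second slot of `![U, V]`. [cite: Helgason2000, Ch. II §5] -/
theorem cmm_pair_smul_right (T : ContinuousMultilinearMap ℝ (fun _ : Fin 2 => Matrix (Fin 3) (Fin 3) ℂ) E) (c : ℝ) (U V : Matrix (Fin 3) (Fin 3) ℂ) :
    T ![U, c • V] = c • T ![U, V] := by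
  have h := T.map_update_smul ![U, V] 1 c V
  have e1 : Function.update ![U, V] 1 (c • V) = ![U, c • V] := by ext i : 1; fin_cases i <;> simp
  have e2 : Function.update ![U, V] 1 V = ![U, V] := by ext i : 1; fin_cases i <;> simp
  rw [e1, e2] at h
  exact h

/-- Finite real combinations in the first slot. [cite: Helgason2000, Ch. II §5] -/
theorem cmm_pair_sum_smul_left (T : ContinuousMultilinearMap ℝ (fun _ : Fin 2 => Matrix (Fin 3) (Fin 3) ℂ) E) {ι : Type*} (s : Finset ι)
    (c : ι → ℝ) (F : ι → Matrix (Fin 3) (Fin 3) ℂ) (V : Matrix (Fin 3) (Fin 3) ℂ) :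
    T ![∑ b ∈ s, c b • F b, V] = ∑ b ∈ s, c b • T ![F b, V] := by
  classical
  induction s using Finset.induction_on with
  | empty =>
    rw [Finset.sum_empty, Finset.sum_empty]
    have h := cmm_pair_smul_left T 0 0 V
    rw [zero_smul, zero_smul] at h
    exact h
  | insert a t hat ih => rw [Finset.sum_insert hat, Finset.sum_insert hat, cmm_pair_add_left, cmm_pair_smul_left, ih]

/-- Finite real combinations in the second slot. [cite: Helgason2000, Ch. II §5] -/
theorem cmm_pair_sum_smul_right (T : ContinuousMultilinearMap ℝ (fun _ : Fin 2 => Matrix (Fin 3) (Fin 3) ℂ) E) {ι : Type*} (s : Finset ι)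
    (d : ι → ℝ) (F : ι → Matrix (Fin 3) (Fin 3) ℂ) (U : Matrix (Fin 3) (Fin 3) ℂ) :
    T ![U, ∑ b' ∈ s, d b' • F b'] = ∑ b' ∈ s, d b' • T ![U, F b'] := by
  classical
  induction s using Finset.induction_on with
  | empty =>
    rw [Finset.sum_empty, Finset.sum_empty]
    have h := cmm_pair_smul_right T 0 U 0
    rw [zero_smul, zero_smul] at h
    exact h
  | insert a t hat ih => rw [Finset.sum_insert hat, Finset.sum_insert hat, cmm_pair_add_right, cmm_pair_smul_right, ih]

/-- A `Fin 2`-multilinear map evaluated on two finite real combinations: `T[Σ_b c_b E_b, Σ_b' d_b' E_b'] = Σ_b Σ_b' c_b d_b' T[E_b, E_b']`. [cite: Helgason2000, Ch. II §5] -/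
theorem cmm_pair_sum_smul_sum_smul (T : ContinuousMultilinearMap ℝ (fun _ : Fin 2 => Matrix (Fin 3) (Fin 3) ℂ) E) {ι : Type*} (s : Finset ι)
    (c d : ι → ℝ) (F : ι → Matrix (Fin 3) (Fin 3) ℂ) :
    T ![∑ b ∈ s, c b • F b, ∑ b' ∈ s, d b' • F b'] = ∑ b ∈ s, ∑ b' ∈ s, (c b * d b') • T ![F b, F b'] := by
  rw [cmm_pair_sum_smul_left]
  refine Finset.sum_congr rfl fun b _ => ?_
  rw [cmm_pair_sum_smul_right, Finset.smul_sum]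
  refine Finset.sum_congr rfl fun b' _ => ?_
  rw [smul_smul]

/-- **THE KEY ORTHOGONALITY RELATION FOR THE `Ad`-COEFFICIENTS**: with `c_{ab}(g) = w_b·Re tr(Ad_g E_a · E_b)` (the coordinates of `Ad_g E_a` in the basis, by §3),
`Σ_a w_a c_{ab} c_{ab′} = δ_{bb′}·w_b` — `Ad_g` is a `B`-isometry of `𝔲(2,1)`. [cite: WarnerHASSLG2, §8.4.1] [cite: Helgason2000, Ch. II §5] -/
theorem sum_lieWeight_mul_coeff_mul_coeff (g : U21) (b b' : Fin 9) :
    ∑ a : Fin 9, lieWeight a * (lieWeight b * (Matrix.trace (mat g * lieBasis a * mat g⁻¹ * lieBasis b)).re)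
        * (lieWeight b' * (Matrix.trace (mat g * lieBasis a * mat g⁻¹ * lieBasis b')).re) =
      if b = b' then lieWeight b else 0 := by
  -- move `Ad_g` to the other side: `tr(Ad_g E_a · E_b) = tr(E_a · Ad_{g⁻¹} E_b)`
  have hU : (mat g⁻¹ * lieBasis b * mat (g⁻¹)⁻¹)ᴴ * J + J * (mat g⁻¹ * lieBasis b * mat (g⁻¹)⁻¹) = 0 := conj_mem_lieAlgebra g⁻¹ (lieBasis_mem b)
  simp_rw [trace_conj_mul g]
  have hkey := sum_lieWeight_mul_re_trace_mul_re_trace (U' := mat g⁻¹ * lieBasis b' * mat (g⁻¹)⁻¹) hU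
  have htr : (Matrix.trace (mat g⁻¹ * lieBasis b * mat (g⁻¹)⁻¹ * (mat g⁻¹ * lieBasis b' * mat (g⁻¹)⁻¹))).re = if b = b' then (lieWeight b)⁻¹ else 0 := by
    rw [trace_conj_mul_conj, re_trace_lieBasis_mul_lieBasis]
  calc ∑ a : Fin 9, lieWeight a * (lieWeight b * (Matrix.trace (lieBasis a * (mat g⁻¹ * lieBasis b * mat (g⁻¹)⁻¹))).re)
          * (lieWeight b' * (Matrix.trace (lieBasis a * (mat g⁻¹ * lieBasis b' * mat (g⁻¹)⁻¹))).re)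
      = lieWeight b * lieWeight b' * ∑ a : Fin 9, lieWeight a * (Matrix.trace (lieBasis a * (mat g⁻¹ * lieBasis b * mat (g⁻¹)⁻¹))).re
          * (Matrix.trace (lieBasis a * (mat g⁻¹ * lieBasis b' * mat (g⁻¹)⁻¹))).re := by
        rw [Finset.mul_sum]
        refine Finset.sum_congr rfl fun a _ => ?_
        ring
    _ = lieWeight b * lieWeight b' * (if b = b' then (lieWeight b)⁻¹ else 0) := by rw [hkey, htr]
    _ = if b = b' then lieWeight b else 0 := by
        split_ifs with hbb
        · subst hbb
          field_simp [lieWeight_ne_zero b]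
        · rw [mul_zero]

/-- **THE CASIMIR TENSOR OF `(𝔲(2,1), Re tr)` IS `Ad(U(2,1))`-INVARIANT**: for every continuous real bilinear `T` (as a `Fin 2`-multilinear map on `M₃(ℂ)`) and every `g ∈ U(2,1)`,
`Σ_a w_a • T[Ad_g E_a, Ad_g E_a] = Σ_a w_a • T[E_a, E_a]`. [cite: WarnerHASSLG2, §8.4.1] [cite: Helgason2000, Ch. II §5] -/
theorem sum_lieWeight_smul_pair_conj_eq (T : ContinuousMultilinearMap ℝ (fun _ : Fin 2 => Matrix (Fin 3) (Fin 3) ℂ) E) (g : U21) :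
    ∑ a : Fin 9, lieWeight a • T ![mat g * lieBasis a * mat g⁻¹, mat g * lieBasis a * mat g⁻¹] = ∑ a : Fin 9, lieWeight a • T ![lieBasis a, lieBasis a] := by
  -- coordinates `c a b` of `Ad_g E_a`, kept opaque
  obtain ⟨c, hc⟩ : ∃ c : Fin 9 → Fin 9 → ℝ, ∀ a b, c a b = lieWeight b * (Matrix.trace (mat g * lieBasis a * mat g⁻¹ * lieBasis b)).re := ⟨_, fun _ _ => rfl⟩
  have hexp : ∀ a : Fin 9, mat g * lieBasis a * mat g⁻¹ = ∑ b : Fin 9, c a b • lieBasis b := by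
    intro a
    simp_rw [hc]
    exact eq_sum_lieWeight_smul_lieBasis (conj_mem_lieAlgebra g (lieBasis_mem a))
  have hkey : ∀ b b' : Fin 9, ∑ a : Fin 9, lieWeight a * (c a b * c a b') = if b = b' then lieWeight b else 0 := by
    intro b b'
    rw [← sum_lieWeight_mul_coeff_mul_coeff g b b']
    refine Finset.sum_congr rfl fun a _ => ?_
    rw [hc, hc]
    ring
  calc ∑ a : Fin 9, lieWeight a • T ![mat g * lieBasis a * mat g⁻¹, mat g * lieBasis a * mat g⁻¹]
      = ∑ a : Fin 9, lieWeight a • ∑ b : Fin 9, ∑ b' : Fin 9, (c a b * c a b') • T ![lieBasis b, lieBasis b'] := by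
        refine Finset.sum_congr rfl fun a _ => ?_
        rw [hexp a, cmm_pair_sum_smul_sum_smul]
    _ = ∑ b : Fin 9, ∑ b' : Fin 9, (∑ a : Fin 9, lieWeight a * (c a b * c a b')) • T ![lieBasis b, lieBasis b'] := by
        simp only [Finset.smul_sum, smul_smul, Finset.sum_smul]
        rw [Finset.sum_comm]
        refine Finset.sum_congr rfl fun b _ => ?_
        rw [Finset.sum_comm]
    _ = ∑ b : Fin 9, ∑ b' : Fin 9, (if b = b' then lieWeight b else 0) • T ![lieBasis b, lieBasis b'] := by
        refine Finset.sum_congr rfl fun b _ => Finset.sum_congr rfl fun b' _ => ?_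
        rw [hkey]
    _ = ∑ a : Fin 9, lieWeight a • T ![lieBasis a, lieBasis a] := by
        refine Finset.sum_congr rfl fun b _ => ?_
        simp only [ite_smul, zero_smul, Finset.sum_ite_eq, Finset.mem_univ, if_true]

end Invariance

/-! ## §5 `∂(ω)` in the `Ad`-moved frame -/

section Laplacian

variable {E : Type*} [NormedAddCommGroup E] [NormedSpace ℝ E]

/-- **HC's `∂(ω)` IS `Ad`-INVARIANT (the form (b1) consumes)**: for any `g ∈ U(2,1)` and any point `X`,
`lieLaplacian f X = Σ_a w_a • D²f(X)[Ad_g E_a, Ad_g E_a]` — the second derivatives may be taken along the MOVED frame `Ad_g E_a`. [cite: WarnerHASSLG2, §8.4.1] [cite: Helgason2000, Ch. II §5] -/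
theorem lieLaplacian_eq_sum_conj (f : Matrix (Fin 3) (Fin 3) ℂ → E) (X : Matrix (Fin 3) (Fin 3) ℂ) (g : U21) :
    lieLaplacian f X = ∑ a : Fin 9, lieWeight a • iteratedFDeriv ℝ 2 f X ![mat g * lieBasis a * mat g⁻¹, mat g * lieBasis a * mat g⁻¹] := by
  rw [lieLaplacian_def]
  exact (sum_lieWeight_smul_pair_conj_eq _ g).symm

end Laplacian

end BallModel

end Literature.Geometry.ComplexHyperbolic

end
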